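import Literature.NumberTheory.EllipticCurves.KugaSatoSchollProjectorBetti
import Literature.NumberTheory.EllipticCurves.KugaSatoVarietySLCommute
import Literature.NumberTheory.EllipticCurves.SchollBettiRealisationProofs
import Literature.AlgebraicGeometry.Motives.RestrictScalarsPoints
import HarnessLib

/-!
# Scholl's projector on the Betti cohomology of `W` regarded over `ℚ`, and `F_∞`

Topic: `Literature/NumberTheory/EllipticCurves`. A Kuga–Sato variety `V : KugaSatoVariety K m N`
of the tree lives over a field `K ∋ ζ_N` (`KugaSatoVariety.lean`); Scholl's `ℚ`-scheme `X̄̄_nʷ`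
is `W` *regarded over `ℚ`*, `W|_ℚ = (W → Spec K → Spec ℚ)`
(`Motives.SchemeOver.restrictScalars`; `SchollBettiRealisationProofs.exists_kugaSato_overRat`),
and the Betti realisation of Scholl's motive, with its infinite Frobenius `F_∞`
(`ModularForms.frobInfty`, Deninger–Scholl (2.2)), is cut out of `Hⁱ(W|_ℚ(ℂ); ℚ)`.
`KugaSatoSchollProjectorBetti.lean` lets `Π_ε ∈ ℚ[Aut W]` (Deninger–Scholl 5.3 (i)) act on the
Betti cohomology of `W` over `K ⊆ ℂ`; this file lets it act on `Hⁱ_B(W|_ℚ)` and records what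
Deninger–Scholl 5.3–5.4 use about it: **`Π_ε` is defined over `ℚ`, hence commutes with `F_∞`**.

* `autBettiRepOver Z i : Aut Z →* End_ℚ Hⁱ_B(Z)`, `g ↦ (g⁻¹)*`, and its linear extension
  `groupAlgBettiAction Z i : ℚ[Aut Z] →ₐ[ℚ] End_ℚ Hⁱ_B(Z)`, for ANY `k`-scheme `Z`, `k ⊆ ℂ`;
  for `k = ℚ`: `groupAlgBettiAction_comp_frobInfty` — every element of `ℚ[Aut Z]` commutes with
  `F_∞` (from the naturality `φ* ∘ F_∞ = F_∞ ∘ φ*` of `SchollBettiRealisationProofs`).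
* `KugaSatoVariety.autRestrict V : Aut W →* Aut (W|_ℚ)` (a `K`-automorphism is a
  `ℚ`-automorphism; Mathlib `Functor.mapAut` of `Over.map`), `bettiActionRat V i :
  ℚ[Aut W] →ₐ[ℚ] End_ℚ Hⁱ_B(W|_ℚ)`, `schollProjectorBettiRat V i = bettiActionRat Π_ε` with
  `schollPartRat V i` its image;
* `schollProjectorBettiRat_comp_frobInfty` — **`Π_ε ∘ F_∞ = F_∞ ∘ Π_ε` on `Hⁱ_B(W|_ℚ)`**, so
  `F_∞` preserves the `ε`-part (`frobInfty_mem_schollPartRat`);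
* idempotency, the action of the generators (`(translW j u)* ∘ Π_ε = Π_ε`,
  `(negW j)* ∘ Π_ε = -Π_ε`, `(permW σ)* ∘ Π_ε = sgn σ • Π_ε`) and the commutation with
  `SL₂(ℤ/N)` on `Hⁱ_B(W|_ℚ)`, transported from the identities in `ℚ[Aut W]` of
  `KugaSatoSchollProjectorEigen.lean` / `KugaSatoVarietySLCommute.lean` exactly as in
  `KugaSatoSchollProjectorBetti(SL).lean`.
* `schollPartRatSL V i` — the `SL₂(ℤ/N)`-invariants of the `ε`-part of `Hⁱ_B(W|_ℚ)` (the piece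
  relevant to level-one forms, as `schollPartSL` over `K`), stable under `F_∞`
  (`frobInfty_mem_schollPartRatSL`), on which `F_∞` restricts to an involution
  (`frobInftySchollPartRatSL`, `frobInftySchollPartRatSL_comp_self`).

As in the companion files: `K : Type` (Betti cohomology), `[CharZero K]` (for `ℚ → K`),
hypothesis `[IsCommMonObj V.curve.E]`; no named facts, no Hodge theory, no identification with
parabolic cohomology or cusp forms is asserted.

## References

* C. Deninger, A. J. Scholl, *The Beilinson conjectures*, in *L-functions and Arithmetic*,
  LMS LNS 153 (1991), (2.2) (p. 151 of the volume: `F_∞`, the `+`-part), 5.1, 5.3 (i) (p. 167: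
  `Π ∈ ℚ[Aut X̄̄_nᵏ]`), (5.4) (pp. 167–168: the `Π_f`-component of `H_B^{k+1}(X̄̄_nᵏ, ℝ(k+l+1))^+`).
  [DeningerScholl1991]
* A. J. Scholl, *Motives for modular forms*, Invent. Math. 100 (1990), §1. [Scholl1990]
-/

open CategoryTheory Limits AlgebraicGeometry MonoidalCategory CartesianMonoidalCategory
open scoped MonObj MatrixGroups

noncomputable section

namespace Literature.NumberTheory.EllipticCurves

open Literature.AlgebraicGeometry.Motives Literature.NumberTheory.EllipticCurves.ModularForms

/-! ### An endomorphism commuting with a monoid action commutes with the monoid algebra -/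

section Generic

variable {M : Type*} [Monoid M] {H : Type*} [AddCommGroup H] [Module ℚ H]
  (φ : MonoidAlgebra ℚ M →ₐ[ℚ] Module.End ℚ H)

/-- If `F` commutes with `φ [g]` for every `g ∈ M`, then `F` commutes with `φ a` for every
`a ∈ ℚ[M]` (linearity). [folklore] -/
theorem comp_eq_comp_of_forall_of (F : Module.End ℚ H)
    (hF : ∀ g : M, φ (MonoidAlgebra.of ℚ M g) ∘ₗ F = F ∘ₗ φ (MonoidAlgebra.of ℚ M g))
    (a : MonoidAlgebra ℚ M) : φ a ∘ₗ F = F ∘ₗ φ a := by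
  induction a using MonoidAlgebra.induction_on with
  | hM g => exact hF g
  | hadd a b ha hb => rw [map_add, LinearMap.add_comp, LinearMap.comp_add, ha, hb]
  | hsmul r a ha => rw [map_smul, LinearMap.smul_comp, LinearMap.comp_smul, ha]

end Generic

/-! ### `Aut Z` and `ℚ[Aut Z]` acting on `Hⁱ_B(Z)` for any `k`-scheme `Z` -/

section AutAction

variable {k : Type} [Field k] [Algebra k ℂ] (Z : SchemeOver k)

/-- **`Aut Z` acts on `Hⁱ_B(Z)`** for a `k`-scheme `Z`, `k ⊆ ℂ`: `g ↦ (g⁻¹)* = (g.inv)*` (pull-back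
is contravariant and `Aut Z` multiplies by `e * f = f ≪≫ e`, so pulling back along the inverse is a
homomorphism into `End_ℚ Hⁱ_B(Z)`). (`KugaSatoVariety.autBettiRep` is the case `Z = W`.)
[folklore] -/
def autBettiRepOver (i : ℕ) : Aut Z →* Module.End ℚ (bettiCohomology Z i) where
  toFun g := (bettiCohomology.map g.inv i).hom
  map_one' := by
    show (bettiCohomology.map (𝟙 Z) i).hom = 1
    rw [bettiCohomology.map_id]
    rfl
  map_mul' e f := by
    show (bettiCohomology.map (e.inv ≫ f.inv) i).hom =
      (bettiCohomology.map e.inv i).hom * (bettiCohomology.map f.inv i).hom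
    rw [bettiCohomology.map_comp]
    rfl

/-- Unfolding of `autBettiRepOver`. [folklore] -/
@[simp]
theorem autBettiRepOver_apply (i : ℕ) (g : Aut Z) :
    autBettiRepOver Z i g = (bettiCohomology.map g.inv i).hom := rfl

/-- **`ℚ[Aut Z]` acts on `Hⁱ_B(Z)`**, the linear extension of `autBettiRepOver`. [folklore] -/
def groupAlgBettiAction (i : ℕ) : MonoidAlgebra ℚ (Aut Z) →ₐ[ℚ] Module.End ℚ (bettiCohomology Z i) :=
  MonoidAlgebra.lift ℚ (Module.End ℚ (bettiCohomology Z i)) (Aut Z) (autBettiRepOver Z i)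

/-- `groupAlgBettiAction [g] = (g⁻¹)*`. [folklore] -/
@[simp]
theorem groupAlgBettiAction_of (i : ℕ) (g : Aut Z) :
    groupAlgBettiAction Z i (MonoidAlgebra.of ℚ _ g) = (bettiCohomology.map g.inv i).hom :=
  MonoidAlgebra.lift_of _ _

/-- Pull-back along an automorphism in terms of the action: `g* = groupAlgBettiAction [g⁻¹]`.
[folklore] -/
theorem map_hom_eq_groupAlgBettiAction (i : ℕ) (g : Aut Z) :
    (bettiCohomology.map g.hom i).hom = groupAlgBettiAction Z i (MonoidAlgebra.of ℚ _ g⁻¹) := by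
  rw [groupAlgBettiAction_of]
  rfl

end AutAction

section OverRat

variable (Z : SchemeOver ℚ)

/-- **`ℚ[Aut Z]` commutes with `F_∞`** for a `ℚ`-scheme `Z`: every `a ∈ ℚ[Aut Z]` acts on
`Hⁱ(Z(ℂ); ℚ)` commuting with the infinite Frobenius of Deninger–Scholl (2.2), by linearity from
the case of a single automorphism (`ModularForms.bettiCohomology_map_comp_frobInfty_self`:
complex conjugation of `Z(ℂ) = Hom(Spec ℂ, Z)` is precomposition, `g(ℂ)` is postcomposition).
[cite: DeningerScholl1991, (2.2)] -/
theorem groupAlgBettiAction_comp_frobInfty (i : ℕ) (a : MonoidAlgebra ℚ (Aut Z)) :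
    groupAlgBettiAction Z i a ∘ₗ frobInfty Z i = frobInfty Z i ∘ₗ groupAlgBettiAction Z i a :=
  comp_eq_comp_of_forall_of (groupAlgBettiAction Z i) (frobInfty Z i)
    (fun g => by
      rw [groupAlgBettiAction_of]
      exact bettiCohomology_map_comp_frobInfty_self g.inv i) a

end OverRat

namespace KugaSatoVariety

variable {K : Type} [Field K] [CharZero K] {m N : ℕ} (V : KugaSatoVariety K m N)

/-! ### `W` regarded over `ℚ` -/

/-- **A `K`-automorphism of `W` is a `ℚ`-automorphism of `W|_ℚ`**: the homomorphism
`Aut W → Aut (W|_ℚ)` induced by the functor `Over.map (Spec K → Spec ℚ)` (restriction of scalars,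
`Motives.SchemeOver.restrictScalars`). [folklore] -/
abbrev autRestrict : Aut V.W →* Aut (V.W.restrictScalars ℚ) :=
  (Over.map (Spec.map (CommRingCat.ofHom (algebraMap ℚ K)))).mapAut V.W

/-- The underlying morphism of `autRestrict g` is that of `g`. [folklore] -/
@[simp]
theorem autRestrict_hom_left (g : Aut V.W) : (V.autRestrict g).hom.left = g.hom.left := rfl

/-- The underlying inverse morphism of `autRestrict g` is that of `g`. [folklore] -/
@[simp]
theorem autRestrict_inv_left (g : Aut V.W) : (V.autRestrict g).inv.left = g.inv.left := rfl

/-- `(autRestrict g).hom = Over.map _ g.hom`. [folklore] -/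
theorem autRestrict_hom (g : Aut V.W) :
    (V.autRestrict g).hom = (Over.map (Spec.map (CommRingCat.ofHom (algebraMap ℚ K)))).map g.hom :=
  rfl

/-- `(autRestrict g).inv = Over.map _ g.inv`. [folklore] -/
theorem autRestrict_inv (g : Aut V.W) :
    (V.autRestrict g).inv = (Over.map (Spec.map (CommRingCat.ofHom (algebraMap ℚ K)))).map g.inv :=
  rfl

/-- **`ℚ[Aut W]` acts on `Hⁱ_B(W|_ℚ) = Hⁱ(W|_ℚ(ℂ); ℚ)`**: `[g] ↦ ((g|_ℚ)⁻¹)*`. [folklore] -/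
def bettiActionRat (i : ℕ) :
    MonoidAlgebra ℚ (Aut V.W) →ₐ[ℚ] Module.End ℚ (bettiCohomology (V.W.restrictScalars ℚ) i) :=
  MonoidAlgebra.lift ℚ _ (Aut V.W) ((autBettiRepOver (V.W.restrictScalars ℚ) i).comp V.autRestrict)

/-- `bettiActionRat [g] = ((g|_ℚ)⁻¹)*`. [folklore] -/
@[simp]
theorem bettiActionRat_of (i : ℕ) (g : Aut V.W) :
    V.bettiActionRat i (MonoidAlgebra.of ℚ _ g) = (bettiCohomology.map (V.autRestrict g).inv i).hom :=
  MonoidAlgebra.lift_of _ _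

/-- `bettiActionRat` factors through the action of `ℚ[Aut (W|_ℚ)]`:
`bettiActionRat [g] = groupAlgBettiAction (W|_ℚ) [g|_ℚ]`. [folklore] -/
theorem bettiActionRat_of_eq_groupAlgBettiAction (i : ℕ) (g : Aut V.W) :
    V.bettiActionRat i (MonoidAlgebra.of ℚ _ g) =
      groupAlgBettiAction (V.W.restrictScalars ℚ) i (MonoidAlgebra.of ℚ _ (V.autRestrict g)) := by
  rw [bettiActionRat_of, groupAlgBettiAction_of]

/-- Pull-back along `g|_ℚ` in terms of the action: `(g|_ℚ)* = bettiActionRat [g⁻¹]`. [folklore] -/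
theorem map_autRestrict_hom_eq_bettiActionRat (i : ℕ) (g : Aut V.W) :
    (bettiCohomology.map (V.autRestrict g).hom i).hom =
      V.bettiActionRat i (MonoidAlgebra.of ℚ _ g⁻¹) := by
  rw [bettiActionRat_of, map_inv]
  rfl

/-- **Every element of `ℚ[Aut W]` acts on `Hⁱ_B(W|_ℚ)` commuting with `F_∞`** (`K`-automorphisms
of `W` are automorphisms of the `ℚ`-scheme `W|_ℚ`). [cite: DeningerScholl1991, (2.2)] -/
theorem bettiActionRat_comp_frobInfty (i : ℕ) (a : MonoidAlgebra ℚ (Aut V.W)) :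
    V.bettiActionRat i a ∘ₗ frobInfty (V.W.restrictScalars ℚ) i =
      frobInfty (V.W.restrictScalars ℚ) i ∘ₗ V.bettiActionRat i a :=
  comp_eq_comp_of_forall_of (V.bettiActionRat i) (frobInfty _ i)
    (fun g => by
      rw [bettiActionRat_of]
      exact bettiCohomology_map_comp_frobInfty_self (V.autRestrict g).inv i) a

/-! ### Scholl's projector on `Hⁱ_B(W|_ℚ)` and `F_∞` -/

/-- **Scholl's projector `Π_ε` acting on `Hⁱ_B(W|_ℚ)`**, the Betti cohomology of `W` regarded over
`ℚ` (Deninger–Scholl 5.1, 5.3 (i): `Π_ε` acts on the cohomology of the `ℚ`-scheme `X̄̄_nʷ`).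
[cite: DeningerScholl1991, 5.3 (i)] -/
def schollProjectorBettiRat [NeZero N] [IsCommMonObj V.curve.E] (i : ℕ) :
    bettiCohomology (V.W.restrictScalars ℚ) i →ₗ[ℚ] bettiCohomology (V.W.restrictScalars ℚ) i :=
  V.bettiActionRat i V.schollProjector

/-- `Π_ε` is idempotent on `Hⁱ_B(W|_ℚ)`. [cite: DeningerScholl1991, 5.3 (i)] -/
theorem isIdempotentElem_schollProjectorBettiRat [NeZero N] [IsCommMonObj V.curve.E] (i : ℕ) :
    IsIdempotentElem (V.schollProjectorBettiRat i) :=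
  V.isIdempotentElem_schollProjector.map (V.bettiActionRat i)

/-- `Π_ε ∘ Π_ε = Π_ε` on `Hⁱ_B(W|_ℚ)`. [cite: DeningerScholl1991, 5.3 (i)] -/
theorem schollProjectorBettiRat_comp_self [NeZero N] [IsCommMonObj V.curve.E] (i : ℕ) :
    V.schollProjectorBettiRat i ∘ₗ V.schollProjectorBettiRat i = V.schollProjectorBettiRat i :=
  (V.isIdempotentElem_schollProjectorBettiRat i).eq

/-- **`Π_ε` commutes with the infinite Frobenius**: `Π_ε ∘ F_∞ = F_∞ ∘ Π_ε` on `Hⁱ_B(W|_ℚ)`.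
`Π` of Deninger–Scholl 5.3 (i) lies in `ℚ[Aut X̄̄_nᵏ]` for the `ℚ`-scheme `X̄̄_nᵏ`, and (5.4) takes
"its `Π_f`-component" of the `+`-part `H_B^{k+1}(X̄̄_nᵏ, ℝ(k+l+1))^+` of (2.2), which uses this
commutation implicitly; it is the `Π_ε`-half of the field `proj_comp_frobInfty` of
`ModularForms.SchollBettiRealisation`. [cite: DeningerScholl1991, (2.2), 5.3 (i) and (5.4)] -/
theorem schollProjectorBettiRat_comp_frobInfty [NeZero N] [IsCommMonObj V.curve.E] (i : ℕ) :
    V.schollProjectorBettiRat i ∘ₗ frobInfty (V.W.restrictScalars ℚ) i =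
      frobInfty (V.W.restrictScalars ℚ) i ∘ₗ V.schollProjectorBettiRat i :=
  V.bettiActionRat_comp_frobInfty i V.schollProjector

/-- Pointwise form: `Π_ε (F_∞ x) = F_∞ (Π_ε x)`. [cite: DeningerScholl1991, 5.3 (i) and 5.4] -/
theorem schollProjectorBettiRat_frobInfty [NeZero N] [IsCommMonObj V.curve.E] (i : ℕ)
    (x : bettiCohomology (V.W.restrictScalars ℚ) i) :
    V.schollProjectorBettiRat i (frobInfty _ i x) = frobInfty _ i (V.schollProjectorBettiRat i x) :=
  LinearMap.congr_fun (V.schollProjectorBettiRat_comp_frobInfty i) x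

/-- **The `ε`-part `Π_ε Hⁱ_B(W|_ℚ)`** of the Betti cohomology of `W` regarded over `ℚ`.
[cite: DeningerScholl1991, 5.3 (i)] -/
def schollPartRat [NeZero N] [IsCommMonObj V.curve.E] (i : ℕ) :
    Submodule ℚ (bettiCohomology (V.W.restrictScalars ℚ) i) :=
  LinearMap.range (V.schollProjectorBettiRat i)

/-- `x ∈ Π_ε Hⁱ_B(W|_ℚ) ↔ Π_ε x = x`. [folklore] -/
theorem mem_schollPartRat_iff [NeZero N] [IsCommMonObj V.curve.E] (i : ℕ)
    (x : bettiCohomology (V.W.restrictScalars ℚ) i) :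
    x ∈ V.schollPartRat i ↔ V.schollProjectorBettiRat i x = x := by
  constructor
  · intro hx
    obtain ⟨y, rfl⟩ := LinearMap.mem_range.mp hx
    exact LinearMap.congr_fun (V.schollProjectorBettiRat_comp_self i) y
  · intro hx
    exact LinearMap.mem_range.mpr ⟨x, hx⟩

/-- **`F_∞` preserves the `ε`-part** of `Hⁱ_B(W|_ℚ)`. [cite: DeningerScholl1991, 5.3 (i) and 5.4] -/
theorem frobInfty_mem_schollPartRat [NeZero N] [IsCommMonObj V.curve.E] {i : ℕ}
    {x : bettiCohomology (V.W.restrictScalars ℚ) i} (hx : x ∈ V.schollPartRat i) :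
    frobInfty _ i x ∈ V.schollPartRat i := by
  obtain ⟨y, rfl⟩ := LinearMap.mem_range.mp hx
  exact LinearMap.mem_range.mpr ⟨_, V.schollProjectorBettiRat_frobInfty i y⟩

/-! ### The generators and `SL₂(ℤ/N)` on `Hⁱ_B(W|_ℚ)` -/

/-- **Translations act trivially on the `ε`-part of `Hⁱ_B(W|_ℚ)`**:
`(translW j u |_ℚ)* ∘ Π_ε = Π_ε`. [cite: DeningerScholl1991, 5.3 (i)] -/
theorem map_translW_comp_schollProjectorBettiRat [NeZero N] [IsCommMonObj V.curve.E] (i : ℕ)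
    (j : Fin m) (u : ZMod N × ZMod N) :
    (bettiCohomology.map (V.autRestrict (V.translA j u)).hom i).hom ∘ₗ V.schollProjectorBettiRat i =
      V.schollProjectorBettiRat i := by
  rw [map_autRestrict_hom_eq_bettiActionRat, schollProjectorBettiRat, ← Module.End.mul_eq_comp,
    ← map_mul, ← V.translA_neg_eq_inv j u, of_translA_mul_schollProjector]

/-- **Inversions act by `-1` on the `ε`-part of `Hⁱ_B(W|_ℚ)`**: `(negW j |_ℚ)* ∘ Π_ε = -Π_ε`.
[cite: DeningerScholl1991, 5.3 (i)] -/
theorem map_negW_comp_schollProjectorBettiRat [NeZero N] [IsCommMonObj V.curve.E] (i : ℕ)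
    (j : Fin m) :
    (bettiCohomology.map (V.autRestrict (V.negA j)).hom i).hom ∘ₗ V.schollProjectorBettiRat i =
      -V.schollProjectorBettiRat i := by
  rw [map_autRestrict_hom_eq_bettiActionRat, schollProjectorBettiRat, ← Module.End.mul_eq_comp,
    ← map_mul, negA_inv, of_negA_mul_schollProjector, map_neg]

/-- **Permutations act through the sign on the `ε`-part of `Hⁱ_B(W|_ℚ)`**:
`(permW σ |_ℚ)* ∘ Π_ε = sgn(σ) Π_ε`. [cite: DeningerScholl1991, 5.3 (i)] -/
theorem map_permW_comp_schollProjectorBettiRat [NeZero N] [IsCommMonObj V.curve.E] (i : ℕ)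
    (σ : Equiv.Perm (Fin m)) :
    (bettiCohomology.map (V.autRestrict (V.permA σ)).hom i).hom ∘ₗ V.schollProjectorBettiRat i =
      permSign m σ • V.schollProjectorBettiRat i := by
  rw [map_autRestrict_hom_eq_bettiActionRat, schollProjectorBettiRat, ← Module.End.mul_eq_comp,
    ← map_mul, show (V.permA σ)⁻¹ = V.permA σ⁻¹ from (map_inv V.permHom σ).symm,
    of_permA_mul_schollProjector, map_smul, permSign_inv]

/-- **`SL₂(ℤ/N)` commutes with `Π_ε` on `Hⁱ_B(W|_ℚ)`**: `(slW g |_ℚ)* ∘ Π_ε = Π_ε ∘ (slW g |_ℚ)*`.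
[cite: DeningerScholl1991, 5.3 (i)] -/
theorem map_slW_comp_schollProjectorBettiRat [NeZero N] [IsCommMonObj V.curve.E] (i : ℕ)
    (g : SL(2, ZMod N)) :
    (bettiCohomology.map (V.autRestrict (V.slA g)).hom i).hom ∘ₗ V.schollProjectorBettiRat i =
      V.schollProjectorBettiRat i ∘ₗ (bettiCohomology.map (V.autRestrict (V.slA g)).hom i).hom := by
  rw [map_autRestrict_hom_eq_bettiActionRat, schollProjectorBettiRat, ← Module.End.mul_eq_comp,
    ← Module.End.mul_eq_comp, ← map_mul, ← map_mul, (V.commute_schollProjector_of_slA_inv g).eq]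

/-- On `x ∈ Π_ε Hⁱ_B(W|_ℚ)`: translations fix `x`. [cite: DeningerScholl1991, 5.3 (i)] -/
theorem map_translW_of_mem_schollPartRat [NeZero N] [IsCommMonObj V.curve.E] {i : ℕ}
    {x : bettiCohomology (V.W.restrictScalars ℚ) i} (hx : x ∈ V.schollPartRat i) (j : Fin m)
    (u : ZMod N × ZMod N) :
    bettiCohomology.map (V.autRestrict (V.translA j u)).hom i x = x := by
  obtain ⟨y, rfl⟩ := LinearMap.mem_range.mp hx
  exact LinearMap.congr_fun (V.map_translW_comp_schollProjectorBettiRat i j u) y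

/-- On `x ∈ Π_ε Hⁱ_B(W|_ℚ)`: inversions act by `-1`. [cite: DeningerScholl1991, 5.3 (i)] -/
theorem map_negW_of_mem_schollPartRat [NeZero N] [IsCommMonObj V.curve.E] {i : ℕ}
    {x : bettiCohomology (V.W.restrictScalars ℚ) i} (hx : x ∈ V.schollPartRat i) (j : Fin m) :
    bettiCohomology.map (V.autRestrict (V.negA j)).hom i x = -x := by
  obtain ⟨y, rfl⟩ := LinearMap.mem_range.mp hx
  exact LinearMap.congr_fun (V.map_negW_comp_schollProjectorBettiRat i j) y

/-- On `x ∈ Π_ε Hⁱ_B(W|_ℚ)`: permutations act through the sign.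
[cite: DeningerScholl1991, 5.3 (i)] -/
theorem map_permW_of_mem_schollPartRat [NeZero N] [IsCommMonObj V.curve.E] {i : ℕ}
    {x : bettiCohomology (V.W.restrictScalars ℚ) i} (hx : x ∈ V.schollPartRat i)
    (σ : Equiv.Perm (Fin m)) :
    bettiCohomology.map (V.autRestrict (V.permA σ)).hom i x = permSign m σ • x := by
  obtain ⟨y, rfl⟩ := LinearMap.mem_range.mp hx
  exact LinearMap.congr_fun (V.map_permW_comp_schollProjectorBettiRat i σ) y

/-- **`SL₂(ℤ/N)` preserves the `ε`-part of `Hⁱ_B(W|_ℚ)`**. [cite: DeningerScholl1991, 5.3 (i)] -/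
theorem map_slW_mem_schollPartRat [NeZero N] [IsCommMonObj V.curve.E] {i : ℕ}
    {x : bettiCohomology (V.W.restrictScalars ℚ) i} (hx : x ∈ V.schollPartRat i)
    (g : SL(2, ZMod N)) :
    bettiCohomology.map (V.autRestrict (V.slA g)).hom i x ∈ V.schollPartRat i := by
  obtain ⟨y, rfl⟩ := LinearMap.mem_range.mp hx
  exact LinearMap.mem_range.mpr
    ⟨_, (LinearMap.congr_fun (V.map_slW_comp_schollProjectorBettiRat i g) y).symm⟩

/-- **`Π_ε Hⁱ_B(W|_ℚ)` is the joint `ε`-eigenspace** (as for `Hⁱ_B(W)` over `K`,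
`mem_schollPart_iff_forall`): `x` lies in it iff every translation `t ∈ ((ℤ/N)²)^m` fixes `x`,
every `s ∈ (ℤ/2)^m` acts by `∏ᵢ (-1)^{sᵢ}` and every `σ ∈ S_m` by `sgn(σ)` (actions through
`bettiActionRat [g] = ((g|_ℚ)⁻¹)*`). [cite: DeningerScholl1991, 5.3 (i)] -/
theorem mem_schollPartRat_iff_forall [NeZero N] [IsCommMonObj V.curve.E] (i : ℕ)
    (x : bettiCohomology (V.W.restrictScalars ℚ) i) :
    x ∈ V.schollPartRat i ↔
      (∀ t : Fin m → Multiplicative (ZMod N × ZMod N),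
          V.bettiActionRat i (MonoidAlgebra.of ℚ _ (V.translPiHom t)) x = x) ∧
        (∀ s : Fin m → Multiplicative (ZMod 2),
          V.bettiActionRat i (MonoidAlgebra.of ℚ _ (V.negPiHom s)) x = negPiSign m s • x) ∧
        ∀ σ : Equiv.Perm (Fin m),
          V.bettiActionRat i (MonoidAlgebra.of ℚ _ (V.permA σ)) x = permSign m σ • x := by
  constructor
  · intro hx
    obtain ⟨y, rfl⟩ := LinearMap.mem_range.mp hx
    refine ⟨fun t => ?_, fun s => ?_, fun σ => ?_⟩
    · rw [schollProjectorBettiRat, ← Module.End.mul_apply, ← map_mul,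
        of_translPiHom_mul_schollProjector]
    · rw [schollProjectorBettiRat, ← Module.End.mul_apply, ← map_mul,
        of_negPiHom_mul_schollProjector, map_smul, LinearMap.smul_apply]
    · rw [schollProjectorBettiRat, ← Module.End.mul_apply, ← map_mul, of_permA_mul_schollProjector,
        map_smul, LinearMap.smul_apply]
  · rintro ⟨hT, hM, hS⟩
    rw [mem_schollPartRat_iff, schollProjectorBettiRat, schollProjector, map_mul, map_mul,
      Module.End.mul_apply, Module.End.mul_apply]
    have eS : V.bettiActionRat i V.permProjector x = x :=
      characterProjector_apply_eq_self _ _ _ fun σ => by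
        rw [permHom_apply, hS, permSign_inv]
    have eM : V.bettiActionRat i V.negProjector x = x :=
      characterProjector_apply_eq_self _ _ _ fun s => by rw [hM, negPi_inv_eq_self]
    have eT : V.bettiActionRat i V.translProjector x = x :=
      characterProjector_apply_eq_self _ _ _ fun t => by rw [hT, MonoidHom.one_apply, one_smul]
    rw [eS, eM, eT]

/-! ### The `SL₂(ℤ/N)`-invariants of the `ε`-part of `Hⁱ_B(W|_ℚ)`, and `F_∞` -/

/-- Pointwise form of `map_slW_comp_schollProjectorBettiRat`:
`(slW g |_ℚ)* (Π_ε x) = Π_ε ((slW g |_ℚ)* x)`. [cite: DeningerScholl1991, 5.3 (i)] -/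
theorem map_slW_schollProjectorBettiRat [NeZero N] [IsCommMonObj V.curve.E] (i : ℕ)
    (g : SL(2, ZMod N)) (x : bettiCohomology (V.W.restrictScalars ℚ) i) :
    bettiCohomology.map (V.autRestrict (V.slA g)).hom i (V.schollProjectorBettiRat i x) =
      V.schollProjectorBettiRat i (bettiCohomology.map (V.autRestrict (V.slA g)).hom i x) :=
  LinearMap.congr_fun (V.map_slW_comp_schollProjectorBettiRat i g) x

/-- **The `SL₂(ℤ/N)`-invariants of the `ε`-part of `Hⁱ_B(W|_ℚ)`**: the classes
`x ∈ Π_ε Hⁱ_B(W|_ℚ)` with `(slW g |_ℚ)* x = x` for all `g ∈ SL₂(ℤ/N)` — over `ℚ`, the piece of the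
cohomology of Scholl's `ℚ`-scheme relevant to level-one forms (invariants under
`SL₂(ℤ/N) = Γ(1)/±Γ(N)` descend level `N` to level one; design notes of `KugaSatoVariety.lean`;
`schollPartSL` is the same piece of `Hⁱ_B(W)` over `K`). [folklore] -/
def schollPartRatSL [NeZero N] [IsCommMonObj V.curve.E] (i : ℕ) :
    Submodule ℚ (bettiCohomology (V.W.restrictScalars ℚ) i) :=
  V.schollPartRat i ⊓
    ⨅ g : SL(2, ZMod N),
      LinearMap.eqLocus (bettiCohomology.map (V.autRestrict (V.slA g)).hom i).hom LinearMap.id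

/-- Membership in `schollPartRatSL`. [folklore] -/
theorem mem_schollPartRatSL_iff [NeZero N] [IsCommMonObj V.curve.E] (i : ℕ)
    (x : bettiCohomology (V.W.restrictScalars ℚ) i) :
    x ∈ V.schollPartRatSL i ↔
      x ∈ V.schollPartRat i ∧
        ∀ g : SL(2, ZMod N), bettiCohomology.map (V.autRestrict (V.slA g)).hom i x = x := by
  simp only [schollPartRatSL, Submodule.mem_inf, Submodule.mem_iInf, LinearMap.mem_eqLocus,
    LinearMap.id_apply]

/-- `schollPartRatSL ≤ schollPartRat`. [folklore] -/
theorem schollPartRatSL_le_schollPartRat [NeZero N] [IsCommMonObj V.curve.E] (i : ℕ) :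
    V.schollPartRatSL i ≤ V.schollPartRat i :=
  inf_le_left

/-- **`Π_ε` of an `SL₂(ℤ/N)`-invariant class of `Hⁱ_B(W|_ℚ)` is an `SL₂(ℤ/N)`-invariant class of the
`ε`-part** (`(slW g |_ℚ)*` commutes with `Π_ε`). [folklore] -/
theorem schollProjectorBettiRat_mem_schollPartRatSL [NeZero N] [IsCommMonObj V.curve.E] (i : ℕ)
    {x : bettiCohomology (V.W.restrictScalars ℚ) i}
    (hx : ∀ g : SL(2, ZMod N), bettiCohomology.map (V.autRestrict (V.slA g)).hom i x = x) :
    V.schollProjectorBettiRat i x ∈ V.schollPartRatSL i := by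
  rw [mem_schollPartRatSL_iff]
  exact ⟨LinearMap.mem_range_self _ x, fun g => by rw [map_slW_schollProjectorBettiRat, hx g]⟩

/-- `Π_ε` is the identity on `schollPartRatSL`. [folklore] -/
theorem schollProjectorBettiRat_apply_of_mem_schollPartRatSL [NeZero N] [IsCommMonObj V.curve.E]
    (i : ℕ) {x : bettiCohomology (V.W.restrictScalars ℚ) i} (hx : x ∈ V.schollPartRatSL i) :
    V.schollProjectorBettiRat i x = x :=
  (V.mem_schollPartRat_iff i x).mp ((V.mem_schollPartRatSL_iff i x).mp hx).1

/-- **`F_∞` preserves the `SL₂(ℤ/N)`-invariants of the `ε`-part of `Hⁱ_B(W|_ℚ)`** (`F_∞` commutes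
with `Π_ε` and with every `(slW g |_ℚ)*`, Deninger–Scholl (2.2)). [cite: DeningerScholl1991, (2.2)] -/
theorem frobInfty_mem_schollPartRatSL [NeZero N] [IsCommMonObj V.curve.E] {i : ℕ}
    {x : bettiCohomology (V.W.restrictScalars ℚ) i} (hx : x ∈ V.schollPartRatSL i) :
    frobInfty _ i x ∈ V.schollPartRatSL i := by
  rw [mem_schollPartRatSL_iff] at hx ⊢
  exact ⟨V.frobInfty_mem_schollPartRat hx.1, fun g => by rw [bettiCohomology_map_frobInfty, hx.2 g]⟩

/-- **`F_∞` restricts to an involution of `schollPartRatSL`** (the `±`-eigenspaces of which are the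
`+`/`−` parts of Deninger–Scholl (2.2) on this piece). [cite: DeningerScholl1991, (2.2)] -/
def frobInftySchollPartRatSL [NeZero N] [IsCommMonObj V.curve.E] (i : ℕ) :
    V.schollPartRatSL i →ₗ[ℚ] V.schollPartRatSL i :=
  (frobInfty (V.W.restrictScalars ℚ) i).restrict fun _ hx => V.frobInfty_mem_schollPartRatSL hx

/-- Unfolding of `frobInftySchollPartRatSL`. [folklore] -/
@[simp]
theorem frobInftySchollPartRatSL_apply_coe [NeZero N] [IsCommMonObj V.curve.E] (i : ℕ)
    (x : V.schollPartRatSL i) :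
    (V.frobInftySchollPartRatSL i x : bettiCohomology (V.W.restrictScalars ℚ) i) = frobInfty _ i x :=
  rfl

/-- `F_∞ ∘ F_∞ = id` on `schollPartRatSL`. [cite: DeningerScholl1991, (2.2)] -/
theorem frobInftySchollPartRatSL_comp_self [NeZero N] [IsCommMonObj V.curve.E] (i : ℕ) :
    V.frobInftySchollPartRatSL i ∘ₗ V.frobInftySchollPartRatSL i = LinearMap.id := by
  ext x
  simp [frobInfty_frobInfty]

end KugaSatoVariety

end Literature.NumberTheory.EllipticCurves

end
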